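/-
Copyright (c) 2026 the pub-hodgecm-mathlib formalisation cell (harness21).  Prover seat hodgecm-mathlib-LH10-p01 (g10): road M6 «ROW 2 ★ DYADIC TWIN» (LEAD F0P3a-plan T14-66),
dealer LH4-plan (g8) WORD #44 DEAL g8-#11 «W-ODD PLACE HEAD» (F4-c′) = the WILD ODD-DISCRIMINANT (uniformiser-frame) twin of ★ (D5) `TypeTwoUnitIndexAtPlace` (F0P3a-p08 g18) WITHOUT
`|2| = 1`, on the Eisenstein engine (L1′)(L2′)(L3′) exactly as ★ (D5)′ `TypeTwoUnitIndexAtPlaceWild` (B-p04 g48); 2026-09-02.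
-/
import Literature.NumberTheory.Automorphic.QuadraticEisensteinOrderNormIndex     -- ★ (L3′) p851869: `relIndex_units_comap_norm_eq_eisenstein`; brings (L1′) p851849 `isUnit_add_mul_iff_eisenstein`, (L2′) p851856
import Literature.NumberTheory.Rogawski1990.TypeTwoUnitIndexAtPlace              -- ★ (D5): `exists_integer_ringHom_of_map_mem_integer` + the place dictionary it imports (★ Σ2-CM, ★ unit norms at an inert place, ★ `valued_toPlace_of_isUnramifiedIn`)
import HarnessLib

/-!
# (D5)″ «[T2-c] DISCHARGE AT THE PLACE», WILD ODD-DISCRIMINANT ROW: the type-(2) unit index `[C : R^×] = (N(v)+1)·N(v)^{N−e+n−1}` at an inert-unramified DYADIC place,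
# uniformiser frame `K = E_w(√k₀)`, no `|2| = 1`

Topic `NumberTheory/Rogawski1990`; namespace `Literature.NumberTheory.Rogawski1990`.  ONE THEOREM (no definition, no instance, no notation, no named fact, no `sorry`); kernel lane
`--supports stmt-HodgeConjecture-24833`.  Cell `pub/hodgecm-mathlib` (D-0151), crux H413; road M6 «ROW 2 ★ DYADIC TWIN» (LEAD F0P3a-plan (g15) T14-66 «ROAD-LIMITED GO»), dealer
LH4-plan (g8) WORD #44 DEAL g8-#11 (F4-c′), after LH4-p01 (g9)'s census SIG-F4a 566a60af: at an inert-unramified place the type-(2) eigen-field `K₂ = E_w(√d)` has `d` a unit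
`1 + w₀` (W-UNIT rows — place head ★ (D5)′ `exists_integers_relIndex_units_comap_norm_eq_place_wildUnit`, level `N + k − e`) OR `d = k₀` a UNIFORMISER of `F_v` (tame row and the
W-ODD dyadic row).  ★ (D5) `exists_integers_relIndex_units_comap_norm_eq_place` covers the uniformiser frame only under `h2 : |2|_w = 1`; THIS FILE is its dyadic-safe twin:
the same statement with `h2` (and the integral lift `e₂O`) DROPPED, the dyadic datum `|2|_v = exp(−e)` as a PARAMETER (`e = 0` recovers the tame head), the two package clauses
`λ₁ ∈ 𝒪[K]`, `|λ₁ − 1| < 1` on `λ₁ = e₂(t + yθ)` taken as HYPOTHESES (outputs of the (D2-β)-shape eigen-field package, as in ★ (D5)′), `ht2` replaced by `|1 − t + D| < 1`, and the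
level read off the integral coordinates of `λ₁` on `(1, θ)`: `p = e₂t`, **`q = e₂y` of order `N′ = N − e`** (`e ≤ N` is OUTPUT).  Proof = ★ (D5)′'s place plumbing verbatim with the
Eisenstein uniformiser `Π` replaced by `θ` itself (`θ² = j(ι 0)·θ + j(ι k₀)`, `0, k₀ ∈ 𝔪_v`) and the final call ★ (L3′) `relIndex_units_comap_norm_eq_eisenstein` at `a = 0`.
Frame: `E ∕ F` quadratic number fields, `c ≠ 1`, `v` unramified in `E`, `w ∣ v` with `c • w = w`, `|2|_v = exp(−e)`; `K = M_{w₁}` for a quadratic `M ⊃ E` ramified at `w` with the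
package `(θ, s̃)` over `k₀` (`θ² = ι₁ι k₀`, coordinates∕integrality on `(1, θ)`, `s̃` over `σ` fixing `θ`, valuation-preserving, unit norms (nK)); eigen-data `u t D y e₂`
(`e₂·2 = 1`, `4D = t² − y²k₀`, unitarity relations, `ord χ(u) = n`, `ord y = N`, `|1 − t + D| < 1`).  OUTPUT: the integral ring maps `ιO σO jO σ₁O`, the integral lifts
`uO tO yO DO pO qO`, `thetaO`, `lamO = jO pO + jO qO·thetaO`, the bound `e ≤ N`, and the INDEX **`[C : R^×] = (N(v) + 1)·N(v)^{N−e+n−1}`** for `R = 𝒪_w[(u, λ₁)] ≤ 𝒪_w × 𝒪[K]`,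
`C = {c : c·c⋆ ∈ R^×}` (side condition `1 ≤ N − e + n`).  KILL discipline (T14-57∕66): no hypothesis excluding `p = 2` — the only `2`-datum is the parameter `he`.
HONEST LABEL: HC_CM is proved only modulo the 7 printed citations (2 remaining named inputs: hLiu418 = stmt-HodgeConjecture-24832, h413 = stmt-HodgeConjecture-24833) until rung 0 closes;
unconditional local algebra, count-neutral ((D-UNR)∕(D-RAM) PRINT; pays no organ, opens no road; zero label movement until F5 ★ + a desk-priced rider).

* **`exists_integers_relIndex_units_comap_norm_eq_place_wildOdd`** — (D5)″.

## References
* [Rogawski1990] J. D. Rogawski, *Automorphic Representations of Unitary Groups in Three Variables* (1990): §4.9 Lemma 4.9.3 p. 56, Prop. 4.9.1 (b) p. 55.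
* [SerreLocalFields1979] J.-P. Serre, *Local Fields*, GTM 67 (1979): Ch. I §6 Prop. 17–18; Ch. II §5 (Eisenstein); Ch. V §2 Prop. 3 and Corollary.
* [Neukirch1999] J. Neukirch, *Algebraic Number Theory*, Grundlehren 322 (1999): Ch. I §12; Ch. II §4 Prop. (4.3).
-/

set_option autoImplicit false

noncomputable section

open ValuativeRel NumberField IsDedekindDomain Polynomial
open scoped ValuativeRel
open Literature.NumberTheory.Automorphic Literature.NumberTheory.Automorphic.UnitaryGroup

namespace Literature.NumberTheory.Rogawski1990

set_option maxHeartbeats 4000000 in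
/-- **(D5)″ «[T2-c] DISCHARGE AT THE PLACE», WILD ODD-DISCRIMINANT ROW (uniformiser frame, no `|2| = 1`)** — see the module docstring.  Frame: `E ∕ F` quadratic number fields,
`c ≠ 1`, `v` unramified in `E`, `w ∣ v` with `c • w = w`, `|2|_v = exp(−e)` (dyadic allowed, `e = 0` tame); `K = M_{w₁}` for a quadratic `M ⊃ E` ramified at `w` with the
(D2-β)-shape package `(θ, s̃)` over the uniformiser `k₀` (`θ² = ι₁ι k₀`); eigen-data `u t D y e₂` with `λ₁ = e₂(t + yθ)` integral and `≡ 1`.  Level `N′ = N − e`.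
[cite: Rogawski1990, §4.9 Lemma 4.9.3 p. 56; Prop. 4.9.1 (b) p. 55] [cite: SerreLocalFields1979, Ch. II §5; Ch. V §2 Prop. 3 and Corollary] [cite: Neukirch1999, Ch. I §12] -/
theorem exists_integers_relIndex_units_comap_norm_eq_place_wildOdd
    {F E : Type} [Field F] [NumberField F] [Field E] [NumberField E] [Algebra F E] [Algebra.IsQuadraticExtension F E]
    (c : E ≃ₐ[F] E) (v : HeightOneSpectrum (𝓞 F)) (hc : c ≠ 1) (hunr : Algebra.IsUnramifiedIn (𝓞 E) v.asIdeal)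
    (w : PlacesOver E v) (hw : c • w.1 = w.1) {e : ℕ} (he : Valued.v (2 : v.adicCompletion F) = WithZero.exp (-(e : ℤ)))
    -- the ramified eigen-field `K = M_{w₁}` and its (D2-β)-shape package over the uniformiser `k₀` of `F_v`
    {M : Type} [Field M] [NumberField M] [Algebra E M] (w₁ : PlacesOver M w.1)
    {k₀ : v.adicCompletion F} (hk₀ : Valued.v k₀ = WithZero.exp (-1 : ℤ))
    {θ : w₁.1.adicCompletion M} (s' : w₁.1.adicCompletion M →+* w₁.1.adicCompletion M)
    (hθ : θ ^ 2 = toPlace w.1 w₁ (toPlace v w k₀))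
    (hcoord : ∀ z : w₁.1.adicCompletion M, ∃! pq : w.1.adicCompletion E × w.1.adicCompletion E, z = toPlace w.1 w₁ pq.1 + toPlace w.1 w₁ pq.2 * θ)
    (hint : ∀ p q : w.1.adicCompletion E, toPlace w.1 w₁ p + toPlace w.1 w₁ q * θ ∈ 𝒪[w₁.1.adicCompletion M] ↔ p ∈ 𝒪[w.1.adicCompletion E] ∧ q ∈ 𝒪[w.1.adicCompletion E])
    (hs'ι : ∀ x, s' (toPlace w.1 w₁ x) = toPlace w.1 w₁ (galAdicCompletionMap (L := E) c hw x)) (hs'θ : s' θ = θ)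
    (hs'O : ∀ z : 𝒪[w₁.1.adicCompletion M], s' z ∈ 𝒪[w₁.1.adicCompletion M]) (hs'v : ∀ z, Valued.v (s' z) = Valued.v z)
    (hnorm1 : ∀ c₁ : w₁.1.adicCompletion M, c₁ ≠ 0 → s' c₁ = c₁ → Even (WithZero.log (Valued.v c₁)) → ∃ a : w₁.1.adicCompletion M, a * s' a * c₁ = 1)
    -- the type-(2) eigen-data of a deep match and the two package clauses on `λ₁ = e₂(t + yθ)`
    (u t D y e₂ : w.1.adicCompletion E) (hu1 : Valued.v (u - 1) < 1) (h2e : e₂ * 2 = 1)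
    (hD : 4 * D = t * t - y * y * toPlace v w k₀)
    (hσu : u * galAdicCompletionMap (L := E) c hw u = 1) (hσD : D * galAdicCompletionMap (L := E) c hw D = 1)
    (hσt : galAdicCompletionMap (L := E) c hw t = t * galAdicCompletionMap (L := E) c hw D)
    (hσy : galAdicCompletionMap (L := E) c hw y = -(y * galAdicCompletionMap (L := E) c hw D))
    {n N : ℕ} (hn : Valued.v (u * u - t * u + D) = WithZero.exp (-(n : ℤ))) (hN : Valued.v y = WithZero.exp (-(N : ℤ)))
    (hχ1 : Valued.v (1 - t + D) < 1)
    (hlamO : (toPlace w.1 w₁ t + toPlace w.1 w₁ y * θ) * toPlace w.1 w₁ e₂ ∈ 𝒪[w₁.1.adicCompletion M])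
    (hlam1 : Valued.v ((toPlace w.1 w₁ t + toPlace w.1 w₁ y * θ) * toPlace w.1 w₁ e₂ - 1) < 1)
    (hNn : 1 ≤ N - e + n) :
    ∃ (ιO : 𝒪[v.adicCompletion F] →+* 𝒪[w.1.adicCompletion E]) (σO : 𝒪[w.1.adicCompletion E] →+* 𝒪[w.1.adicCompletion E]) (jO : 𝒪[w.1.adicCompletion E] →+* 𝒪[w₁.1.adicCompletion M]) (σ₁O : 𝒪[w₁.1.adicCompletion M] →+* 𝒪[w₁.1.adicCompletion M])
      (uO tO yO DO pO qO : 𝒪[w.1.adicCompletion E]) (lamO thetaO : 𝒪[w₁.1.adicCompletion M]),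
      (∀ x : 𝒪[v.adicCompletion F], ((ιO x : 𝒪[w.1.adicCompletion E]) : w.1.adicCompletion E) = toPlace v w x) ∧
      (∀ x : 𝒪[w.1.adicCompletion E], ((σO x : 𝒪[w.1.adicCompletion E]) : w.1.adicCompletion E) = galAdicCompletionMap (L := E) c hw x) ∧
      (∀ x : 𝒪[w.1.adicCompletion E], ((jO x : 𝒪[w₁.1.adicCompletion M]) : w₁.1.adicCompletion M) = toPlace w.1 w₁ x) ∧
      (∀ z : 𝒪[w₁.1.adicCompletion M], ((σ₁O z : 𝒪[w₁.1.adicCompletion M]) : w₁.1.adicCompletion M) = s' z) ∧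
      (uO : w.1.adicCompletion E) = u ∧ (tO : w.1.adicCompletion E) = t ∧ (yO : w.1.adicCompletion E) = y ∧ (DO : w.1.adicCompletion E) = D ∧
      (pO : w.1.adicCompletion E) = e₂ * t ∧ (qO : w.1.adicCompletion E) = e₂ * y ∧
      (thetaO : w₁.1.adicCompletion M) = θ ∧
      (lamO : w₁.1.adicCompletion M) = (toPlace w.1 w₁ t + toPlace w.1 w₁ y * θ) * toPlace w.1 w₁ e₂ ∧ lamO = jO pO + jO qO * thetaO ∧ e ≤ N ∧
      (Units.map ((Polynomial.eval₂RingHom (RingHom.prod (RingHom.id 𝒪[w.1.adicCompletion E]) jO) ((uO, lamO) : 𝒪[w.1.adicCompletion E] × 𝒪[w₁.1.adicCompletion M])).range.subtype :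
          (Polynomial.eval₂RingHom (RingHom.prod (RingHom.id 𝒪[w.1.adicCompletion E]) jO) ((uO, lamO) : 𝒪[w.1.adicCompletion E] × 𝒪[w₁.1.adicCompletion M])).range →* 𝒪[w.1.adicCompletion E] × 𝒪[w₁.1.adicCompletion M])).range.relIndex
        ((Units.map ((Polynomial.eval₂RingHom (RingHom.prod (RingHom.id 𝒪[w.1.adicCompletion E]) jO) ((uO, lamO) : 𝒪[w.1.adicCompletion E] × 𝒪[w₁.1.adicCompletion M])).range.subtype :
          (Polynomial.eval₂RingHom (RingHom.prod (RingHom.id 𝒪[w.1.adicCompletion E]) jO) ((uO, lamO) : 𝒪[w.1.adicCompletion E] × 𝒪[w₁.1.adicCompletion M])).range →* 𝒪[w.1.adicCompletion E] × 𝒪[w₁.1.adicCompletion M])).range.comap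
          (MonoidHom.id (𝒪[w.1.adicCompletion E] × 𝒪[w₁.1.adicCompletion M])ˣ * Units.map (RingHom.prodMap σO σ₁O : 𝒪[w.1.adicCompletion E] × 𝒪[w₁.1.adicCompletion M] →* 𝒪[w.1.adicCompletion E] × 𝒪[w₁.1.adicCompletion M]))) =
        (Ideal.absNorm v.asIdeal + 1) * Ideal.absNorm v.asIdeal ^ (N - e + n - 1) := by
  -- ### 0. Notation-free abbreviations and the valuation bridges (as ★ (D5)∕(D5)′)
  have hσv : ∀ x : w.1.adicCompletion E, Valued.v (galAdicCompletionMap (L := E) c hw x) = Valued.v x :=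
    fun x => valued_galAdicCompletionMap (L := E) c hw x
  have hιv : ∀ y : v.adicCompletion F, Valued.v (toPlace v w y) = Valued.v y :=
    fun y => Literature.NumberTheory.Automorphic.Liu2021.LemD1IndexedNonVacuityInertCofinite.valued_toPlace_of_isUnramifiedIn E v hunr w y
  have hσσK : ∀ x : w.1.adicCompletion E, galAdicCompletionMap (L := E) c hw (galAdicCompletionMap (L := E) c hw x) = x :=
    galAdicCompletionMap_galAdicCompletionMap_of_smul_eq c w hc hw
  have hcc : c * c = 1 := algEquiv_mul_self_eq_one (F := F) hc
  have hsq : ∀ x : WithZero (Multiplicative ℤ), x * x = 1 → x = 1 := fun x h => by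
    rcases eq_or_ne x 0 with h0 | h0
    · rw [h0, zero_mul] at h; exact absurd h zero_ne_one
    · rw [← WithZero.exp_log h0, ← WithZero.exp_add, WithZero.exp_eq_one] at h
      rw [← WithZero.exp_log h0, show WithZero.log x = 0 by omega, WithZero.exp_zero]
  have hunitE : ∀ x : 𝒪[w.1.adicCompletion E], IsUnit x ↔ Valued.v (x : w.1.adicCompletion E) = 1 := fun x => by
    rw [(Valuation.integer.integers (valuation (w.1.adicCompletion E))).isUnit_iff_valuation_eq_one, v_eq_one_iff_valuation_eq_one]; rfl
  have hunitF : ∀ x : 𝒪[v.adicCompletion F], IsUnit x ↔ Valued.v (x : v.adicCompletion F) = 1 := fun x => by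
    rw [(Valuation.integer.integers (valuation (v.adicCompletion F))).isUnit_iff_valuation_eq_one, v_eq_one_iff_valuation_eq_one]; rfl
  have hunitK : ∀ x : 𝒪[w₁.1.adicCompletion M], IsUnit x ↔ Valued.v (x : w₁.1.adicCompletion M) = 1 := fun x => by
    rw [(Valuation.integer.integers (valuation (w₁.1.adicCompletion M))).isUnit_iff_valuation_eq_one, v_eq_one_iff_valuation_eq_one]; rfl
  have hmaxE : ∀ x : 𝒪[w.1.adicCompletion E], Valued.v (x : w.1.adicCompletion E) < 1 → x ∈ IsLocalRing.maximalIdeal 𝒪[w.1.adicCompletion E] :=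
    fun x hx => by rw [IsLocalRing.mem_maximalIdeal, mem_nonunits_iff, hunitE]; exact hx.ne
  have hmaxF : ∀ x : 𝒪[v.adicCompletion F], Valued.v (x : v.adicCompletion F) < 1 → x ∈ IsLocalRing.maximalIdeal 𝒪[v.adicCompletion F] :=
    fun x hx => by rw [IsLocalRing.mem_maximalIdeal, mem_nonunits_iff, hunitF]; exact hx.ne
  -- ### 1. The dyadic arithmetic of the level: `|e₂| = exp e`, `|q| = |e₂ y| = exp (e − N) ≤ 1`, `e ≤ N`
  have h2v : Valued.v (2 : w.1.adicCompletion E) = WithZero.exp (-(e : ℤ)) := by rw [← map_ofNat (toPlace v w) 2, hιv, he]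
  have he₂v : Valued.v e₂ = WithZero.exp (e : ℤ) := by
    have h := congrArg Valued.v h2e
    rw [map_mul, h2v, map_one] at h
    calc Valued.v e₂ = Valued.v e₂ * (WithZero.exp (-(e : ℤ)) * WithZero.exp (e : ℤ)) := by rw [← WithZero.exp_add, neg_add_cancel, WithZero.exp_zero, mul_one]
      _ = WithZero.exp (e : ℤ) := by rw [← mul_assoc, h, one_mul]
  have hsmul : ∀ m : ℕ, m • (-1 : ℤ) = -(m : ℤ) := fun m => by simp
  have hqv : Valued.v (e₂ * y) = WithZero.exp ((e : ℤ) - N) := by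
    have hz : (e : ℤ) + -(N : ℤ) = (e : ℤ) - N := by ring
    rw [map_mul, he₂v, hN, ← WithZero.exp_add, hz]
  -- the coordinates of `λ₁` on `(1, θ)`: `p = e₂ t`, `q = e₂ y`
  have hlam_coord : (toPlace w.1 w₁ t + toPlace w.1 w₁ y * θ) * toPlace w.1 w₁ e₂ =
      toPlace w.1 w₁ (e₂ * t) + toPlace w.1 w₁ (e₂ * y) * θ := by
    rw [map_mul, map_mul]; ring
  have hpqO : e₂ * t ∈ 𝒪[w.1.adicCompletion E] ∧ e₂ * y ∈ 𝒪[w.1.adicCompletion E] :=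
    (hint _ _).1 (hlam_coord ▸ hlamO)
  have heN : e ≤ N := by
    have h := (v_le_one_iff_mem_integer _).2 hpqO.2
    rw [hqv, ← WithZero.exp_zero, WithZero.exp_le_exp] at h
    omega
  -- ### 2. Integrality of the remaining data
  have hle_of_sub : ∀ {x c₀ : w.1.adicCompletion E}, Valued.v (x - c₀) < 1 → Valued.v c₀ ≤ 1 → Valued.v x ≤ 1 := fun {x c₀} hx hc₀ => by
    have := Valued.v.map_add_le hx.le hc₀; rwa [sub_add_cancel] at this
  have huO : u ∈ 𝒪[w.1.adicCompletion E] := (v_le_one_iff_mem_integer u).1 (hle_of_sub hu1 (by rw [map_one]))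
  have hDv : Valued.v D = 1 := hsq _ (by have h := congrArg Valued.v hσD; rwa [map_mul, hσv, map_one] at h)
  have hDO : D ∈ 𝒪[w.1.adicCompletion E] := (v_le_one_iff_mem_integer D).1 hDv.le
  have htO : t ∈ 𝒪[w.1.adicCompletion E] := (v_le_one_iff_mem_integer t).1 (by
    have h1 : Valued.v (t - (1 + D)) < 1 := by rw [← Valuation.map_neg, neg_sub, show 1 + D - t = 1 - t + D by ring]; exact hχ1
    exact hle_of_sub h1 (le_trans (Valuation.map_add _ _ _) (max_le (by rw [map_one]) hDv.le)))
  have hyO : y ∈ 𝒪[w.1.adicCompletion E] := (v_le_one_iff_mem_integer y).1 (by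
    rw [hN, ← WithZero.exp_zero]; exact WithZero.exp_le_exp.2 (by omega))
  have hθO : θ ∈ 𝒪[w₁.1.adicCompletion M] := by
    have h := (hint 0 1).2 ⟨zero_mem _, one_mem _⟩
    rwa [map_zero, map_one, zero_add, one_mul] at h
  have hk₀O : k₀ ∈ 𝒪[v.adicCompletion F] := (v_le_one_iff_mem_integer k₀).1 (by
    rw [hk₀, ← WithZero.exp_zero]; exact WithZero.exp_le_exp.2 (by norm_num))
  -- the Eisenstein relation of the uniformiser frame: `θ² = ι(0)·θ + ι(k₀)`, both coefficients in `𝔪_v`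
  have hθsq : θ ^ 2 = toPlace w.1 w₁ (toPlace v w 0) * θ + toPlace w.1 w₁ (toPlace v w k₀) := by
    rw [map_zero, map_zero, zero_mul, zero_add]; exact hθ
  -- ### 3. The integral ring maps and the integral lifts
  obtain ⟨ιO, hιO⟩ := exists_integer_ringHom_toPlace v w
  obtain ⟨jO, hjO⟩ := exists_integer_ringHom_toPlace w.1 w₁
  obtain ⟨σO, hσO⟩ := exists_integer_ringHom_of_map_mem_integer (galAdicCompletionMap (L := E) c hw) (mem_integer_galAdicCompletionMap c v w hw)
  obtain ⟨σ₁O, hσ₁O⟩ := exists_integer_ringHom_of_map_mem_integer s' hs'O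
  obtain ⟨uO, huO'⟩ : ∃ uO : 𝒪[w.1.adicCompletion E], (uO : w.1.adicCompletion E) = u := ⟨⟨u, huO⟩, rfl⟩
  obtain ⟨tO, htO'⟩ : ∃ tO : 𝒪[w.1.adicCompletion E], (tO : w.1.adicCompletion E) = t := ⟨⟨t, htO⟩, rfl⟩
  obtain ⟨yO, hyO'⟩ : ∃ yO : 𝒪[w.1.adicCompletion E], (yO : w.1.adicCompletion E) = y := ⟨⟨y, hyO⟩, rfl⟩
  obtain ⟨DO, hDO'⟩ : ∃ DO : 𝒪[w.1.adicCompletion E], (DO : w.1.adicCompletion E) = D := ⟨⟨D, hDO⟩, rfl⟩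
  obtain ⟨pO, hpO'⟩ : ∃ pO : 𝒪[w.1.adicCompletion E], (pO : w.1.adicCompletion E) = e₂ * t := ⟨⟨_, hpqO.1⟩, rfl⟩
  obtain ⟨qO, hqO'⟩ : ∃ qO : 𝒪[w.1.adicCompletion E], (qO : w.1.adicCompletion E) = e₂ * y := ⟨⟨_, hpqO.2⟩, rfl⟩
  obtain ⟨thetaO, hthetaO'⟩ : ∃ thetaO : 𝒪[w₁.1.adicCompletion M], (thetaO : w₁.1.adicCompletion M) = θ := ⟨⟨θ, hθO⟩, rfl⟩
  obtain ⟨aF, haF'⟩ : ∃ aF : 𝒪[v.adicCompletion F], (aF : v.adicCompletion F) = 0 := ⟨0, rfl⟩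
  obtain ⟨k₀F, hk₀F'⟩ : ∃ k₀F : 𝒪[v.adicCompletion F], (k₀F : v.adicCompletion F) = k₀ := ⟨⟨_, hk₀O⟩, rfl⟩
  obtain ⟨lamO, hlamOdef⟩ : ∃ lamO : 𝒪[w₁.1.adicCompletion M], lamO = jO pO + jO qO * thetaO := ⟨_, rfl⟩
  have hlamO' : (lamO : w₁.1.adicCompletion M) = (toPlace w.1 w₁ t + toPlace w.1 w₁ y * θ) * toPlace w.1 w₁ e₂ := by
    rw [hlamOdef, Subring.coe_add, Subring.coe_mul, hjO, hjO, hpO', hqO', hthetaO', hlam_coord]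
  -- ### 4. The dictionary binders of (L3′) `relIndex_units_comap_norm_eq_eisenstein`
  have hσσ : ∀ x, σO (σO x) = x := fun x => Subtype.ext (by rw [hσO, hσO, hσσK])
  have hσι : ∀ y', σO (ιO y') = ιO y' := fun y' => Subtype.ext (by rw [hσO, hιO, galAdicCompletionMap_toPlace c w w hw])
  have hfixO : ∀ x, σO x = x → ∃ y', ιO y' = x := fun x hx =>
    exists_map_eq_of_galAdicCompletionMap_eq v w c hc hw ιO hιO x (by rw [← hσO, hx])
  have hιinj : Function.Injective ιO := injective_of_coe_eq_toPlace v w ιO hιO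
  have hιu : ∀ y', IsUnit (ιO y') → IsUnit y' := fun y' h => by
    rw [hunitF]; rw [hunitE, hιO, hιv] at h; exact h
  have hσ₁j : ∀ x, σ₁O (jO x) = jO (σO x) := fun x => Subtype.ext (by rw [hσ₁O, hjO, hjO, hσO, hs'ι])
  have hσ₁θ : σ₁O thetaO = thetaO := Subtype.ext (by rw [hσ₁O, hthetaO']; exact hs'θ)
  have hθ' : thetaO ^ 2 = jO (ιO aF) * thetaO + jO (ιO k₀F) :=
    Subtype.ext (by rw [Subring.coe_pow, Subring.coe_add, Subring.coe_mul, hjO, hjO, hιO, hιO, hthetaO', haF', hk₀F']; exact hθsq)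
  have haF : aF ∈ IsLocalRing.maximalIdeal 𝒪[v.adicCompletion F] := hmaxF _ (by rw [haF', map_zero]; exact zero_lt_one)
  have hk₀' : k₀F ∈ IsLocalRing.maximalIdeal 𝒪[v.adicCompletion F] := hmaxF _ (by
    rw [hk₀F', hk₀, ← WithZero.exp_zero]; exact WithZero.exp_lt_exp.2 (by norm_num))
  have hcoordO : ∀ z : 𝒪[w₁.1.adicCompletion M], ∃! bc : 𝒪[w.1.adicCompletion E] × 𝒪[w.1.adicCompletion E], z = jO bc.1 + jO bc.2 * thetaO := by
    intro z
    obtain ⟨⟨p, q⟩, hz, huniq⟩ := hcoord (z : w₁.1.adicCompletion M)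
    have hpq : p ∈ 𝒪[w.1.adicCompletion E] ∧ q ∈ 𝒪[w.1.adicCompletion E] := (hint p q).1 (hz ▸ z.2)
    refine ⟨(⟨p, hpq.1⟩, ⟨q, hpq.2⟩), Subtype.ext ?_, fun bc hbc => ?_⟩
    · rw [Subring.coe_add, Subring.coe_mul, hjO, hjO, hthetaO']; exact hz
    · have hbc' : (z : w₁.1.adicCompletion M) = toPlace w.1 w₁ bc.1 + toPlace w.1 w₁ bc.2 * θ := by
        have := congrArg (fun x : 𝒪[w₁.1.adicCompletion M] => (x : w₁.1.adicCompletion M)) hbc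
        simp only [Subring.coe_add, Subring.coe_mul, hjO, hthetaO'] at this
        exact this
      have h := huniq (((bc.1 : w.1.adicCompletion E)), (bc.2 : w.1.adicCompletion E)) hbc'
      rw [Prod.mk.injEq] at h
      exact Prod.ext (Subtype.ext h.1) (Subtype.ext h.2)
  -- the quadratic relation of `λ₁` (in the field: `e₂·2 = 1`, `4D = t² − y²k₀`, `θ² = k₀`)
  have h2e' : toPlace w.1 w₁ e₂ * 2 = 1 := by
    have := congrArg (toPlace w.1 w₁) h2e; rwa [map_mul, map_ofNat, map_one] at this
  have hD₁ : 4 * toPlace w.1 w₁ D = toPlace w.1 w₁ t * toPlace w.1 w₁ t - toPlace w.1 w₁ y * toPlace w.1 w₁ y * θ ^ 2 := by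
    have := congrArg (toPlace w.1 w₁) hD; rw [map_mul, map_ofNat, map_sub, map_mul, map_mul, map_mul] at this; rw [this, hθ]
  have hlamroot : ((toPlace w.1 w₁ t + toPlace w.1 w₁ y * θ) * toPlace w.1 w₁ e₂) ^ 2
      - toPlace w.1 w₁ t * ((toPlace w.1 w₁ t + toPlace w.1 w₁ y * θ) * toPlace w.1 w₁ e₂) + toPlace w.1 w₁ D = 0 := by
    linear_combination (toPlace w.1 w₁ e₂ ^ 2) * hD₁ +
      (toPlace w.1 w₁ e₂ * toPlace w.1 w₁ t * (toPlace w.1 w₁ t + toPlace w.1 w₁ y * θ) - (1 + 2 * toPlace w.1 w₁ e₂) * toPlace w.1 w₁ D) * h2e'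
  have hlam2 : lamO ^ 2 - jO tO * lamO + jO DO = 0 := Subtype.ext (by
    push_cast; rw [hjO, hjO, hlamO', htO', hDO']; exact hlamroot)
  have hlam' : lamO = jO pO + jO qO * thetaO := hlamOdef
  -- locality binders
  have hu1' : uO - 1 ∈ IsLocalRing.maximalIdeal 𝒪[w.1.adicCompletion E] := hmaxE _ (by push_cast; rw [huO']; exact hu1)
  have hχ1' : 1 - tO + DO ∈ IsLocalRing.maximalIdeal 𝒪[w.1.adicCompletion E] := hmaxE _ (by push_cast; rw [htO', hDO']; exact hχ1)
  have hp1' : pO - 1 ∈ IsLocalRing.maximalIdeal 𝒪[w.1.adicCompletion E] := by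
    have ha' : ιO aF ∈ IsLocalRing.maximalIdeal 𝒪[w.1.adicCompletion E] := map_k₀_mem_maximalIdeal ιO hιu haF
    have hk' : ιO k₀F ∈ IsLocalRing.maximalIdeal 𝒪[w.1.adicCompletion E] := map_k₀_mem_maximalIdeal ιO hιu hk₀'
    have hnu : ¬ IsUnit (lamO - 1) := by
      rw [hunitK, AddSubgroupClass.coe_sub, Subring.coe_one, hlamO']; exact hlam1.ne
    rw [hlam', show jO pO + jO qO * thetaO - 1 = jO (pO - 1) + jO qO * thetaO by rw [map_sub, map_one]; ring,
      isUnit_add_mul_iff_eisenstein jO thetaO hθ' ha' hk' hcoordO] at hnu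
    exact (IsLocalRing.mem_maximalIdeal _).2 (mem_nonunits_iff.2 hnu)
  -- unitarity of the generator: `u σu = 1`, `λ₁ s'λ₁ = e₂² σD (t² − y²k₀) = 1`
  have hσlam : (toPlace w.1 w₁ t + toPlace w.1 w₁ y * θ) * toPlace w.1 w₁ e₂ * s' ((toPlace w.1 w₁ t + toPlace w.1 w₁ y * θ) * toPlace w.1 w₁ e₂) = 1 := by
    have hs'e₂ : s' (toPlace w.1 w₁ e₂) = toPlace w.1 w₁ e₂ := by
      have hσe₂ : galAdicCompletionMap (L := E) c hw e₂ = e₂ := by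
        have h1 : galAdicCompletionMap (L := E) c hw e₂ * 2 = 1 := by
          have := congrArg (galAdicCompletionMap (L := E) c hw) h2e; rwa [map_mul, map_ofNat, map_one] at this
        calc galAdicCompletionMap (L := E) c hw e₂ = galAdicCompletionMap (L := E) c hw e₂ * (e₂ * 2) := by rw [h2e, mul_one]
          _ = (galAdicCompletionMap (L := E) c hw e₂ * 2) * e₂ := by ring
          _ = e₂ := by rw [h1, one_mul]
      rw [hs'ι, hσe₂]
    have hσD₁ : toPlace w.1 w₁ D * toPlace w.1 w₁ (galAdicCompletionMap (L := E) c hw D) = 1 := by rw [← map_mul, hσD, map_one]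
    rw [map_mul, map_add, map_mul, hs'e₂, hs'ι, hs'ι, hs'θ, hσt, hσy, map_mul, map_neg, map_mul]
    linear_combination (-(toPlace w.1 w₁ e₂ ^ 2 * toPlace w.1 w₁ (galAdicCompletionMap (L := E) c hw D))) * hD₁ +
      ((2 * toPlace w.1 w₁ e₂ + 1) * toPlace w.1 w₁ D * toPlace w.1 w₁ (galAdicCompletionMap (L := E) c hw D)) * h2e' + hσD₁
  have hxstar : ((uO, lamO) : 𝒪[w.1.adicCompletion E] × 𝒪[w₁.1.adicCompletion M]) * RingHom.prodMap σO σ₁O (uO, lamO) = 1 := by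
    change ((uO, lamO) : 𝒪[w.1.adicCompletion E] × 𝒪[w₁.1.adicCompletion M]) * (σO uO, σ₁O lamO) = 1
    rw [Prod.mk_mul_mk, Prod.mk_eq_one]
    exact ⟨Subtype.ext (by rw [Subring.coe_mul, hσO, huO', Subring.coe_one]; exact hσu),
      Subtype.ext (by rw [Subring.coe_mul, hσ₁O, hlamO', Subring.coe_one]; exact hσlam)⟩
  -- unit norms (nE), (nK): verbatim from ★ (D5)
  have hnormE : ∀ a : 𝒪[w.1.adicCompletion E], IsUnit a → σO a = a → ∃ b, b * σO b = a := fun a ha hσa => by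
    obtain ⟨b, hb⟩ := LocalFields.UnramifiedQuadraticNorm.exists_mul_galAdicCompletionMap_eq_of_inert c v hc hcc hunr w hw a ha
      (by have := congrArg (fun x : 𝒪[w.1.adicCompletion E] => (x : w.1.adicCompletion E)) hσa; rwa [hσO] at this)
    exact ⟨b, Subtype.ext (by rw [Subring.coe_mul, hσO]; exact hb)⟩
  have hnorm₁ : ∀ z : 𝒪[w₁.1.adicCompletion M], IsUnit z → σ₁O z = z → ∃ w', w' * σ₁O w' = z := fun z hz hσz => by
    have hz1 : Valued.v (z : w₁.1.adicCompletion M) = 1 := (hunitK z).1 hz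
    have hz0 : (z : w₁.1.adicCompletion M) ≠ 0 := fun h0 => by rw [h0, map_zero] at hz1; exact zero_ne_one hz1
    have hσz' : s' (z : w₁.1.adicCompletion M) = z := by
      have := congrArg (fun x : 𝒪[w₁.1.adicCompletion M] => (x : w₁.1.adicCompletion M)) hσz; rwa [hσ₁O] at this
    obtain ⟨a, ha⟩ := hnorm1 z hz0 hσz' (by rw [hz1, WithZero.log_one]; exact ⟨0, rfl⟩)
    have hav' : Valued.v a = 1 := hsq _ (by
      have h := congrArg Valued.v ha
      rwa [map_mul, map_mul, hs'v, hz1, mul_one, map_one] at h)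
    have ha0 : a ≠ 0 := fun h0 => by rw [h0, map_zero] at hav'; exact zero_ne_one hav'
    have haO' : a⁻¹ ∈ 𝒪[w₁.1.adicCompletion M] := (v_le_one_iff_mem_integer _).1 (by rw [map_inv₀, hav', inv_one])
    refine ⟨⟨a⁻¹, haO'⟩, Subtype.ext ?_⟩
    rw [Subring.coe_mul, hσ₁O]
    change a⁻¹ * s' a⁻¹ = (z : w₁.1.adicCompletion M)
    rw [map_inv₀, ← mul_inv, ← mul_right_inj' (mul_ne_zero ha0 ((map_ne_zero s').2 ha0)), mul_inv_cancel₀ (mul_ne_zero ha0 ((map_ne_zero s').2 ha0)), ha]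
  -- uniformisers (`k₀` itself), valuations of the eigen-data (level `N − e`)
  have hϖF : IsUniformizingElement k₀ := isUniformizingElement_of_v_eq hk₀
  have hιk₀v : Valued.v (toPlace v w k₀) = WithZero.exp (-1 : ℤ) := by rw [hιv, hk₀]
  have hϖE : IsUniformizingElement (toPlace v w k₀) := isUniformizingElement_of_v_eq hιk₀v
  have hιϖ : ιO ⟨k₀, hϖF.mem⟩ = ⟨toPlace v w k₀, hϖE.mem⟩ := Subtype.ext (hιO _)
  have hpow : ∀ m : ℕ, Valued.v (toPlace v w k₀ ^ m) = WithZero.exp (-(m : ℤ)) := fun m => by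
    rw [map_pow, hιk₀v, ← WithZero.exp_nsmul, hsmul]
  have hn' : valuation (w.1.adicCompletion E) ((uO * uO - tO * uO + DO : 𝒪[w.1.adicCompletion E]) : w.1.adicCompletion E) =
      valuation (w.1.adicCompletion E) (toPlace v w k₀) ^ n := by
    rw [← map_pow, ← v_eq_iff_valuation_eq, hpow]; push_cast; rw [huO', htO', hDO']; exact hn
  have hN' : valuation (w.1.adicCompletion E) ((qO : 𝒪[w.1.adicCompletion E]) : w.1.adicCompletion E) =
      valuation (w.1.adicCompletion E) (toPlace v w k₀) ^ (N - e) := by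
    have hz : (e : ℤ) - N = -((N - e : ℕ) : ℤ) := by push_cast [heN]; ring
    rw [← map_pow, ← v_eq_iff_valuation_eq, hpow, hqO', hqv, hz]
  have hq : Nat.card 𝓀[w.1.adicCompletion E] = Nat.card 𝓀[v.adicCompletion F] ^ 2 := natCard_residueField_eq_natCard_residueField_sq c v hc hunr w hw
  obtain ⟨ξ, hξ0⟩ := exists_isUnit_galAdicCompletionMap_sub c v hc hunr w hw
  have hξ : IsUnit (ξ - σO ξ) := by
    have h := hξ0.neg
    rw [neg_sub] at h
    have hσOξ : σO ξ = ⟨galAdicCompletionMap (L := E) c hw ξ, mem_integer_galAdicCompletionMap c v w hw ξ⟩ := Subtype.ext (hσO ξ)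
    rw [hσOξ]
    exact h
  -- ### 5. Assembly
  refine ⟨ιO, σO, jO, σ₁O, uO, tO, yO, DO, pO, qO, lamO, thetaO, hιO, hσO, hjO, hσ₁O, huO', htO', hyO', hDO', hpO', hqO', hthetaO', hlamO', hlam', heN, ?_⟩
  rw [← natCard_residueField_eq_absNorm v]
  exact relIndex_units_comap_norm_eq_eisenstein ιO σO jO σ₁O thetaO uO hσσ hσι hfixO hιinj hιu hσ₁j hσ₁θ hθ' haF hk₀' hcoordO hlam' hlam2 hu1' hp1' hχ1' hxstar
    hnormE hnorm₁ hϖF hϖE hιϖ hn' hN' hq hξ hNn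

end Literature.NumberTheory.Rogawski1990

end
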